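import Summits.Parity.BatemanHorn.Theses.IsogenyRedei
import Summits.Parity.BatemanHorn.Theorems.IsogenyRedeiOmegaToMobiusAPCounting
import Summits.Parity.BatemanHorn.Theorems.IsogenyRedeiOmegaToMobiusAPSieve
import Summits.Parity.BatemanHorn.Theorems.IsogenyRedeiQuadraticOmegaParityLiouvilleAPToOmegaLemmas
import Literature.NumberTheory.Sieve.PolynomialCongruencesRootCount

/-!
# Junction `QuadraticOmegaParity → LiouvilleAP` (crux stmt-Parity-11585, reverse direction)

The crux `QuadraticOmegaParity` of route `IsogenyRedei` (`Σ_{n ≤ x, n ≡ a (q)} (−1)^{ω(f(n))} =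
o(x)` for every irreducible integer quadratic `f` with positive leading coefficient, every `q ≥ 1`
and `a`) implies the same for Liouville's `λ(f(n))` (Mathlib's `ArithmeticFunction.liouville`;
values `f(n) ≤ 0` through `toNat`); with the forward junction `liouvilleAP_to_quadraticOmegaParity`
the crux is thus Chowla's conjecture along progressions for integer quadratics, in either currency.
Proof: the valuation-truncated squarefree sieve of `…LiouvilleAPToOmegaLemmas`, run backwards.  For
a level `L`, a cut-off `K` and `M = q·(L!)^K`, on the good `n` (`n ≥ N₀`; no prime `p > L` with
`p² ∣ f(n)`; no prime `p ≤ L` with `p^K ∣ f(n)`) one has `(−1)^{ω(f(n))} = θ(n mod M)·λ(f(n))`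
with a sign `θ`, hence `λ(f(n)) = θ(n mod M)·(−1)^{ω(f(n))}`; indeed pointwise
`|λ − θχ(−1)^ω| ≤ |(−1)^ω − θχλ|` (`abs_liouville_pointwise_error_le`), so the discarded `n` and
their bound `2N₀ + W(L+1)(x/2^K + 1) + 4x/L + 4π(Bx)` are those of the forward direction
(`sum_error_le`; `W` from `exists_polyRootCountMod_prime_pow_le`), and the surviving sum is a
finite combination of the hypothesis' class sums modulo `M` (`core_estimate`).  Then `K = W(L+1)L`
and `L = 3R → ∞` via `isLittleO_of_forall_approx`.  Main theorem
`quadraticOmegaParity_to_liouvilleAP`, registered alias `stub_omegaAP_to_liouvilleAP`.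
-/

open Filter Finset Asymptotics Polynomial

namespace Summit.Parity.BatemanHorn.Theorems.OmegaAPToLiouville

open Summit.Parity.BatemanHorn.Theorems.OmegaToMobiusAP

/-! ### The pointwise error, reversed -/

/-- `|l − θ χ s| ≤ |s − θ χ l|` for a sign `θ = (−1)^N`, `|s| = 1`, `|l| ≤ 1` and an indicator
`χ = 1[P]`. [folklore] -/
theorem abs_sub_sign_mul_le (N : ℕ) {s l : ℝ} (hs : |s| = 1) (hl : |l| ≤ 1) (P : Prop)
    [Decidable P] :
    |l - (-1 : ℝ) ^ N * (if P then (1 : ℝ) else 0) * s|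
      ≤ |s - (-1 : ℝ) ^ N * (if P then (1 : ℝ) else 0) * l| := by
  have hθ2 : (-1 : ℝ) ^ N * (-1) ^ N = 1 := by rw [← mul_pow]; norm_num
  split_ifs
  · have e : l - (-1 : ℝ) ^ N * 1 * s = -(-1 : ℝ) ^ N * (s - (-1 : ℝ) ^ N * 1 * l) := by
      linear_combination (-l) * hθ2
    rw [e, abs_mul, abs_neg, abs_pow, abs_neg, abs_one, one_pow, one_mul]
  · simp only [mul_zero, zero_mul, sub_zero]
    rw [hs]; exact hl

/-- **Pointwise error, reversed.** With `g n = f(n).toNat`, `s n = (−1)^{ω(g n)}`, `M = q (L!)^K`,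
`θ(c) = (−1)^{Σ_{p ≤ L, p ∣ f(c)} (v_p(f(c)) + 1)}`, `χ n = 1[∀ p ≤ L prime, p^K ∤ f(n mod M)]`:
`|λ(g n) − θ(n mod M) χ(n) s(n)| ≤ 2·1[n < N₀] + Σ_{p ≤ L} 1[p^K ∣ f(n)]
  + 2 Σ_{L < p ≤ Bx} 1[p² ∣ f(n)]` for `1 ≤ n ≤ x` — dominated by the forward error of
`LiouvilleAPToOmega.abs_pointwise_error_le`. [folklore] -/
theorem abs_liouville_pointwise_error_le (f : ℤ[X]) (N₀ : ℕ)
    (hN₀ : ∀ n : ℕ, N₀ ≤ n → 0 < f.eval (n : ℤ)) (Bh : ℕ) (hBh1 : 1 ≤ Bh)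
    (hBh : ∀ n x : ℕ, 1 ≤ n → n ≤ x → f.eval (n : ℤ) ≤ (Bh : ℤ) * (x : ℤ) ^ 2)
    (q L K : ℕ) {x n : ℕ} (hn : n ∈ Finset.Icc 1 x) :
    |(ArithmeticFunction.liouville ((f.eval (n : ℤ)).toNat) : ℝ)
        - (-1 : ℝ) ^ (∑ p ∈ (Nat.primesLE L).filter
              (fun p : ℕ => (p : ℤ) ∣ f.eval (((n % (q * Nat.factorial L ^ K) : ℕ)) : ℤ)),
              (padicValInt p (f.eval (((n % (q * Nat.factorial L ^ K) : ℕ)) : ℤ)) + 1))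
          * (if ∀ p ∈ Nat.primesLE L,
                ¬ ((p : ℤ) ^ K ∣ f.eval (((n % (q * Nat.factorial L ^ K) : ℕ)) : ℤ))
              then (1 : ℝ) else 0)
          * (-1 : ℝ) ^ ArithmeticFunction.cardDistinctFactors ((f.eval (n : ℤ)).toNat)|
      ≤ 2 * (if n < N₀ then (1 : ℝ) else 0)
        + (∑ p ∈ Nat.primesLE L, if (p : ℤ) ^ K ∣ f.eval (n : ℤ) then (1 : ℝ) else 0)
        + 2 * ∑ p ∈ (Nat.primesLE (Bh * x)).filter (fun p => L < p),
            (if (p : ℤ) ^ 2 ∣ f.eval (n : ℤ) then (1 : ℝ) else 0) :=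
  (abs_sub_sign_mul_le _ (by rw [abs_pow, abs_neg, abs_one, one_pow])
      (Literature.NumberTheory.Sieve.abs_liouville_le_one _) _).trans
    (LiouvilleAPToOmega.abs_pointwise_error_le f N₀ hN₀ Bh hBh1 hBh q L K hn)

/-! ### The summed error and the core estimate -/

/-- **Summed error** of the valuation-truncated squarefree sieve at a level `L ≥ 1` beyond the bad
primes of `f` and a cut-off `K`: `Σ_{n ≤ x} (2·1[n < N₀] + Σ_{p ≤ L} 1[p^K ∣ f(n)]
  + 2 Σ_{L < p ≤ Bx} 1[p² ∣ f(n)]) ≤ 2N₀ + W(L+1)(x/2^K + 1) + 4x/L + 4π(Bx)`. [folklore] -/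
theorem sum_error_le (f : ℤ[X]) (hf : f.natDegree = 2) (N₀ Bh W : ℕ)
    (hW : ∀ p : ℕ, p.Prime → ∀ k : ℕ,
      ((Finset.range (p ^ k)).filter
        (fun ν : ℕ => ((p ^ k : ℕ) : ℤ) ∣ f.eval (ν : ℤ))).card ≤ W)
    (L K : ℕ) (hL : 0 < L)
    (hgood : ∀ p : ℕ, p.Prime → L < p →
      ¬ (p : ℤ) ∣ 2 * f.coeff 2 * (f.coeff 1 ^ 2 - 4 * f.coeff 2 * f.coeff 0)) (x : ℕ) :
    ∑ n ∈ Finset.Icc 1 x, (2 * (if n < N₀ then (1 : ℝ) else 0)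
        + (∑ p ∈ Nat.primesLE L, if (p : ℤ) ^ K ∣ f.eval (n : ℤ) then (1 : ℝ) else 0)
        + 2 * ∑ p ∈ (Nat.primesLE (Bh * x)).filter (fun p => L < p),
            (if (p : ℤ) ^ 2 ∣ f.eval (n : ℤ) then (1 : ℝ) else 0))
      ≤ 2 * N₀ + W * (L + 1) * ((x : ℝ) / 2 ^ K + 1) + 4 * x / L
          + 4 * (Nat.primesLE (Bh * x)).card := by
  set PR := (Nat.primesLE (Bh * x)).filter (fun p => L < p) with hPR
  have hpiece1 : ∑ n ∈ Finset.Icc 1 x, (2 * (if n < N₀ then (1 : ℝ) else 0)) ≤ 2 * N₀ := by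
    rw [← Finset.mul_sum, ← Finset.sum_filter, Finset.sum_const, nsmul_eq_mul, mul_one]
    have hc : ((Finset.Icc 1 x).filter (fun n => n < N₀)).card ≤ N₀ := by
      calc ((Finset.Icc 1 x).filter (fun n => n < N₀)).card ≤ (Finset.range N₀).card :=
            Finset.card_le_card (fun n hn => by
              rw [Finset.mem_filter] at hn
              exact Finset.mem_range.mpr hn.2)
        _ = N₀ := Finset.card_range _
    exact_mod_cast Nat.mul_le_mul_left 2 hc
  have hpiece2 : ∑ n ∈ Finset.Icc 1 x, ∑ p ∈ Nat.primesLE L,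
      (if (p : ℤ) ^ K ∣ f.eval (n : ℤ) then (1 : ℝ) else 0)
        ≤ W * (L + 1) * ((x : ℝ) / 2 ^ K + 1) := by
    rw [Finset.sum_comm]
    have hcardL : ((Nat.primesLE L).card : ℝ) ≤ L + 1 := by
      have h1 : (Nat.primesLE L).card ≤ (Finset.range (L + 1)).card :=
        Finset.card_le_card (Finset.filter_subset _ _)
      rw [Finset.card_range] at h1
      exact_mod_cast h1
    have hterm : ∀ p ∈ Nat.primesLE L, ∑ n ∈ Finset.Icc 1 x,
        (if (p : ℤ) ^ K ∣ f.eval (n : ℤ) then (1 : ℝ) else 0) ≤ W * ((x : ℝ) / 2 ^ K + 1) := by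
      intro p hp
      have hpp := Nat.prime_of_mem_primesLE hp
      rw [Finset.sum_boole]
      have e : ∀ n : ℕ, ((p : ℤ) ^ K ∣ f.eval (n : ℤ)) ↔ (((p ^ K : ℕ) : ℤ) ∣ f.eval (n : ℤ)) :=
        fun n => by push_cast; exact Iff.rfl
      rw [Finset.filter_congr (fun n _ => e n)]
      have h3 : ((Finset.Icc 1 x).filter
          (fun n : ℕ => ((p ^ K : ℕ) : ℤ) ∣ f.eval (n : ℤ))).card ≤ W * (x / p ^ K + 1) :=
        (LiouvilleAPToOmega.card_filter_Icc_dvd_eval_le f (pow_pos hpp.pos K) x).trans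
          (Nat.mul_le_mul_right _ (hW p hpp K))
      have h4 : (((Finset.Icc 1 x).filter
          (fun n : ℕ => ((p ^ K : ℕ) : ℤ) ∣ f.eval (n : ℤ))).card : ℝ)
            ≤ W * ((x / p ^ K : ℕ) + 1 : ℝ) := by exact_mod_cast h3
      have h5 : ((x / p ^ K : ℕ) : ℝ) ≤ (x : ℝ) / 2 ^ K := by
        calc ((x / p ^ K : ℕ) : ℝ) ≤ (x : ℝ) / ((p ^ K : ℕ) : ℝ) := Nat.cast_div_le
          _ ≤ (x : ℝ) / 2 ^ K := by
            apply div_le_div_of_nonneg_left (Nat.cast_nonneg x) (by positivity)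
            push_cast
            exact pow_le_pow_left₀ (by norm_num) (by exact_mod_cast hpp.two_le) K
      calc _ ≤ W * ((x / p ^ K : ℕ) + 1 : ℝ) := h4
        _ ≤ W * ((x : ℝ) / 2 ^ K + 1) := by gcongr
    calc ∑ p ∈ Nat.primesLE L, ∑ n ∈ Finset.Icc 1 x,
          (if (p : ℤ) ^ K ∣ f.eval (n : ℤ) then (1 : ℝ) else 0)
        ≤ ∑ p ∈ Nat.primesLE L, (W * ((x : ℝ) / 2 ^ K + 1)) := Finset.sum_le_sum hterm
      _ = (Nat.primesLE L).card * (W * ((x : ℝ) / 2 ^ K + 1)) := by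
          rw [Finset.sum_const, nsmul_eq_mul]
      _ ≤ (L + 1) * (W * ((x : ℝ) / 2 ^ K + 1)) := by gcongr
      _ = W * (L + 1) * ((x : ℝ) / 2 ^ K + 1) := by ring
  have hpiece3 : ∑ n ∈ Finset.Icc 1 x, 2 * ∑ p ∈ PR,
      (if (p : ℤ) ^ 2 ∣ f.eval (n : ℤ) then (1 : ℝ) else 0)
        ≤ 2 * (2 * x / L + 2 * (Nat.primesLE (Bh * x)).card) := by
    rw [← Finset.mul_sum, Finset.sum_comm]
    refine mul_le_mul_of_nonneg_left
      (le_trans (Finset.sum_le_sum (fun p hp => ?_)) (sum_local_bounds_le L Bh x hL)) (by norm_num)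
    rw [← Finset.sum_filter, Finset.sum_const, nsmul_eq_mul, mul_one]
    have hpp : p.Prime := (Nat.mem_primesLE.mp (Finset.mem_filter.mp hp).1).2
    have hLp : L < p := (Finset.mem_filter.mp hp).2
    have hcard := card_roots_Icc_le hpp (hgood p hpp hLp) x
    have heq : (Finset.Icc 1 x).filter (fun n : ℕ => (p : ℤ) ^ 2 ∣ f.eval (n : ℤ))
        = (Finset.Icc 1 x).filter
            (fun n : ℕ => (p : ℤ) ^ 2 ∣ f.coeff 2 * n ^ 2 + f.coeff 1 * n + f.coeff 0) := by
      refine Finset.filter_congr (fun n _ => ?_)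
      rw [Literature.NumberTheory.Sieve.eval_eq_of_natDegree_eq_two hf]
    rw [heq]
    exact_mod_cast hcard
  have e4 : (2 : ℝ) * (2 * x / L + 2 * (Nat.primesLE (Bh * x)).card)
      = 4 * x / L + 4 * (Nat.primesLE (Bh * x)).card := by ring
  rw [Finset.sum_add_distrib, Finset.sum_add_distrib]
  linarith

/-- **Core estimate** (reverse junction): for a level `L ≥ 1` beyond the bad primes of `f` and a
cut-off `K` there are weights `w` on the residues modulo `M = q (L!)^K` with
`|Σ_{n ≤ x, n ≡ a (q)} λ(f(n)) − Σ_{c < M} w(c) Σ_{n ≤ x, n ≡ c (M)} (−1)^{ω(f(n))}|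
  ≤ 2N₀ + W(L+1)(x/2^K + 1) + 4x/L + 4π(Bx)`. [folklore] -/
theorem core_estimate (f : ℤ[X]) (hf : f.natDegree = 2)
    (N₀ : ℕ) (hN₀ : ∀ n : ℕ, N₀ ≤ n → 0 < f.eval (n : ℤ)) (Bh : ℕ) (hBh1 : 1 ≤ Bh)
    (hBh : ∀ n x : ℕ, 1 ≤ n → n ≤ x → f.eval (n : ℤ) ≤ (Bh : ℤ) * (x : ℤ) ^ 2)
    (W : ℕ) (hW : ∀ p : ℕ, p.Prime → ∀ k : ℕ,
      ((Finset.range (p ^ k)).filter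
        (fun ν : ℕ => ((p ^ k : ℕ) : ℤ) ∣ f.eval (ν : ℤ))).card ≤ W)
    (L K q a : ℕ) (hq : 0 < q) :
    ∃ w : ℕ → ℝ, 0 < L →
      (∀ p : ℕ, p.Prime → L < p →
        ¬ (p : ℤ) ∣ 2 * f.coeff 2 * (f.coeff 1 ^ 2 - 4 * f.coeff 2 * f.coeff 0)) → ∀ x : ℕ,
      |∑ n ∈ (Finset.Icc 1 x).filter (fun n : ℕ => n ≡ a [MOD q]),
            (ArithmeticFunction.liouville ((f.eval (n : ℤ)).toNat) : ℝ)
        - ∑ c ∈ Finset.range (q * Nat.factorial L ^ K), w c *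
            ∑ n ∈ (Finset.Icc 1 x).filter
              (fun n : ℕ => n ≡ c [MOD q * Nat.factorial L ^ K]),
              (-1 : ℝ) ^ ArithmeticFunction.cardDistinctFactors ((f.eval (n : ℤ)).toNat)|
        ≤ 2 * N₀ + W * (L + 1) * ((x : ℝ) / 2 ^ K + 1) + 4 * x / L
          + 4 * (Nat.primesLE (Bh * x)).card := by
  classical
  set M := q * Nat.factorial L ^ K with hM
  have hMpos : 0 < M := Nat.mul_pos hq (pow_pos (Nat.factorial_pos L) K)
  have hqM : q ∣ M := Dvd.intro _ rfl
  set P : ℕ → Prop := fun c => ∀ p ∈ Nat.primesLE L, ¬ ((p : ℤ) ^ K ∣ f.eval (c : ℤ)) with hP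
  set θ : ℕ → ℝ := fun c => (-1 : ℝ) ^ (∑ p ∈ (Nat.primesLE L).filter
      (fun p : ℕ => (p : ℤ) ∣ f.eval (c : ℤ)), (padicValInt p (f.eval (c : ℤ)) + 1)) with hθ
  refine ⟨fun c => if c ≡ a [MOD q] ∧ P c then θ c else 0, fun hL hgood x => ?_⟩
  beta_reduce
  set A := (Finset.Icc 1 x).filter (fun n : ℕ => n ≡ a [MOD q]) with hA
  set s : ℕ → ℝ := fun n =>
    (-1 : ℝ) ^ ArithmeticFunction.cardDistinctFactors ((f.eval (n : ℤ)).toNat) with hs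
  set lam : ℕ → ℝ := fun n => (ArithmeticFunction.liouville ((f.eval (n : ℤ)).toNat) : ℝ)
    with hlam
  set χ : ℕ → ℝ := fun n => if P (n % M) then 1 else 0 with hχ
  -- Step 1: the main term is `Σ_{n ∈ A} θ (n % M) * χ n * s n`
  have hmain : ∑ c ∈ Finset.range M, (if c ≡ a [MOD q] ∧ P c then θ c else 0) *
        ∑ n ∈ (Finset.Icc 1 x).filter (fun n : ℕ => n ≡ c [MOD M]), s n
      = ∑ n ∈ A, θ (n % M) * χ n * s n := by
    calc ∑ c ∈ Finset.range M, (if c ≡ a [MOD q] ∧ P c then θ c else 0) *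
          ∑ n ∈ (Finset.Icc 1 x).filter (fun n : ℕ => n ≡ c [MOD M]), s n
        = ∑ c ∈ (Finset.range M).filter (fun c : ℕ => c ≡ a [MOD q] ∧ P c),
            θ c * ∑ n ∈ (Finset.Icc 1 x).filter (fun n : ℕ => n ≡ c [MOD M]), s n := by
          rw [Finset.sum_filter]
          exact Finset.sum_congr rfl (fun c _ => by split_ifs <;> simp)
      _ = ∑ c ∈ (Finset.range M).filter (fun c : ℕ => c ≡ a [MOD q] ∧ P c),
            ∑ n ∈ (Finset.Icc 1 x).filter (fun n : ℕ => n ≡ c [MOD M]),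
              θ (n % M) * s n := by
          refine Finset.sum_congr rfl (fun c hc => ?_)
          rw [Finset.mul_sum]
          refine Finset.sum_congr rfl (fun n hn => ?_)
          have hcM : c < M := Finset.mem_range.mp (Finset.mem_filter.mp hc).1
          have hnc : n % M = c := by
            have h1 : n ≡ c [MOD M] := (Finset.mem_filter.mp hn).2
            unfold Nat.ModEq at h1
            rw [h1, Nat.mod_eq_of_lt hcM]
          rw [hnc]
      _ = ∑ n ∈ (Finset.Icc 1 x).filter (fun n : ℕ => n ≡ a [MOD q] ∧ P (n % M)),
            θ (n % M) * s n :=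
          (sum_filter_modEq_regroup (fun n => θ (n % M) * s n) P hMpos hqM a x).symm
      _ = ∑ n ∈ A, θ (n % M) * χ n * s n := by
          rw [hA, ← Finset.filter_filter, Finset.sum_filter]
          exact Finset.sum_congr rfl (fun n _ => by simp only [hχ]; split_ifs <;> simp)
  -- Step 2: the pointwise error `abs_liouville_pointwise_error_le`, summed over `A ⊆ [1, x]`
  have hdiff : ∑ n ∈ A, lam n
      - ∑ c ∈ Finset.range M, (if c ≡ a [MOD q] ∧ P c then θ c else 0) *
          ∑ n ∈ (Finset.Icc 1 x).filter (fun n : ℕ => n ≡ c [MOD M]), s n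
      = ∑ n ∈ A, (lam n - θ (n % M) * χ n * s n) := by
    rw [hmain, Finset.sum_sub_distrib]
  rw [hdiff]
  calc |∑ n ∈ A, (lam n - θ (n % M) * χ n * s n)|
      ≤ ∑ n ∈ A, |lam n - θ (n % M) * χ n * s n| := Finset.abs_sum_le_sum_abs _ _
    _ ≤ ∑ n ∈ A, (2 * (if n < N₀ then (1 : ℝ) else 0)
          + (∑ p ∈ Nat.primesLE L, if (p : ℤ) ^ K ∣ f.eval (n : ℤ) then (1 : ℝ) else 0)
          + 2 * ∑ p ∈ (Nat.primesLE (Bh * x)).filter (fun p => L < p),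
              (if (p : ℤ) ^ 2 ∣ f.eval (n : ℤ) then (1 : ℝ) else 0)) :=
        Finset.sum_le_sum (fun n hn => abs_liouville_pointwise_error_le f N₀ hN₀ Bh hBh1 hBh
          q L K (Finset.mem_filter.mp hn).1)
    _ ≤ ∑ n ∈ Finset.Icc 1 x, (2 * (if n < N₀ then (1 : ℝ) else 0)
          + (∑ p ∈ Nat.primesLE L, if (p : ℤ) ^ K ∣ f.eval (n : ℤ) then (1 : ℝ) else 0)
          + 2 * ∑ p ∈ (Nat.primesLE (Bh * x)).filter (fun p => L < p),
              (if (p : ℤ) ^ 2 ∣ f.eval (n : ℤ) then (1 : ℝ) else 0)) := by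
        refine Finset.sum_le_sum_of_subset_of_nonneg (Finset.filter_subset _ _)
          (fun n _ _ => ?_)
        refine add_nonneg (add_nonneg (by split_ifs <;> norm_num)
          (Finset.sum_nonneg (fun p _ => ?_)))
          (mul_nonneg (by norm_num) (Finset.sum_nonneg (fun p _ => ?_))) <;>
        split_ifs <;> norm_num
    _ ≤ _ := sum_error_le f hf N₀ Bh W hW L K hL hgood x

end Summit.Parity.BatemanHorn.Theorems.OmegaAPToLiouville

namespace Summit.Parity.BatemanHorn.Theorems

open Summit.Parity.BatemanHorn.Theses.IsogenyRedei
open Summit.Parity.BatemanHorn.Theorems.OmegaToMobiusAP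

/-- **Reverse junction of line `Sketch` (crux stmt-Parity-11585).** ω-parity of the values of
every irreducible integer quadratic along every arithmetic progression (`QuadraticOmegaParity`)
implies Liouville parity `Σ_{n ≤ x, n ≡ a (q)} λ(f(n)) = o(x)` along every arithmetic
progression, by the valuation-truncated squarefree sieve run backwards. [folklore] -/
theorem quadraticOmegaParity_to_liouvilleAP :
    Summit.Parity.BatemanHorn.Theses.IsogenyRedei.QuadraticOmegaParity →
    ∀ f : Polynomial ℤ, Irreducible f → f.natDegree = 2 → 0 < f.leadingCoeff → ∀ q a : ℕ, 0 < q →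
      (fun x : ℕ => ∑ n ∈ (Finset.Icc 1 x).filter (fun n : ℕ => n ≡ a [MOD q]),
        (ArithmeticFunction.liouville ((f.eval (n : ℤ)).toNat) : ℝ)) =o[Filter.atTop]
          fun x : ℕ => (x : ℝ) := by
  intro H f hirr hf hlc q a hq
  -- the constants attached to `f = A X² + B X + C`
  set A := f.coeff 2 with hAdef
  set B := f.coeff 1 with hBdef
  set C := f.coeff 0 with hCdef
  have hA : 0 < A := by
    rw [Polynomial.leadingCoeff, hf] at hlc; exact hlc
  have hD : B ^ 2 - 4 * A * C ≠ 0 :=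
    Literature.NumberTheory.Sieve.discrim_ne_zero_of_irreducible hf hirr
  set N₀ : ℕ := B.natAbs + C.natAbs + 1 with hN₀def
  set Bh : ℕ := A.natAbs + B.natAbs + C.natAbs with hBhdef
  set R₀ : ℕ := (2 * A * (B ^ 2 - 4 * A * C)).natAbs + 1 with hR₀def
  have hN₀ : ∀ n : ℕ, N₀ ≤ n → 0 < f.eval (n : ℤ) := by
    intro n hn
    rw [Literature.NumberTheory.Sieve.eval_eq_of_natDegree_eq_two hf]
    apply quadratic_pos hA
    have h1 : ((N₀ : ℕ) : ℤ) ≤ n := by exact_mod_cast hn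
    have h2 : ((N₀ : ℕ) : ℤ) = |B| + |C| + 1 := by simp [hN₀def]
    linarith
  have hBh1 : 1 ≤ Bh := le_add_right (le_add_right (Int.natAbs_pos.mpr hA.ne'))
  have hBh : ∀ n x : ℕ, 1 ≤ n → n ≤ x → f.eval (n : ℤ) ≤ (Bh : ℤ) * (x : ℤ) ^ 2 := by
    intro n x h1 h2
    rw [Literature.NumberTheory.Sieve.eval_eq_of_natDegree_eq_two hf]
    have h := quadratic_le hA (B := B) (C := C) (n := (n : ℤ)) (x := (x : ℤ))
      (by exact_mod_cast h1) (by exact_mod_cast h2)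
    have e : ((Bh : ℕ) : ℤ) = A + |B| + |C| := by simp [hBhdef, abs_of_pos hA]
    rw [e]
    exact h
  have hgood : ∀ p : ℕ, p.Prime → R₀ ≤ p → ¬ (p : ℤ) ∣ 2 * A * (B ^ 2 - 4 * A * C) := by
    intro p hp hRp hdvd
    have hne : 2 * A * (B ^ 2 - 4 * A * C) ≠ 0 := mul_ne_zero (mul_ne_zero two_ne_zero hA.ne') hD
    have hle : p ≤ (2 * A * (B ^ 2 - 4 * A * C)).natAbs :=
      Nat.le_of_dvd (Int.natAbs_pos.mpr hne) (Int.natAbs_dvd_natAbs.mpr hdvd)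
    omega
  -- the Nagell–Hensel constant `W`: `ρ_f(p^k) ≤ W` for every prime `p` and every `k`
  obtain ⟨Mf, -, hMf⟩ :=
    Literature.NumberTheory.Sieve.exists_polyRootCountMod_prime_pow_le hirr (by rw [hf]; norm_num)
  set W : ℕ := 2 * Mf with hWdef
  have hW : ∀ p : ℕ, p.Prime → ∀ k : ℕ,
      ((Finset.range (p ^ k)).filter
        (fun ν : ℕ => ((p ^ k : ℕ) : ℤ) ∣ f.eval (ν : ℤ))).card ≤ W := by
    intro p hp k
    rw [Literature.NumberTheory.Sieve.card_filter_dvd_eval_eq_polyRootCountMod, hWdef, ← hf]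
    exact hMf p hp k
  -- `π(B·x) = o(x)`
  have htend : Tendsto (fun x : ℕ => Bh * x) atTop atTop :=
    Filter.tendsto_atTop_mono (fun x => Nat.le_mul_of_pos_left x hBh1) tendsto_id
  have hπ : (fun x : ℕ => ((Nat.primesLE (Bh * x)).card : ℝ)) =o[atTop] (fun x : ℕ => (x : ℝ)) := by
    have h1 := isLittleO_card_primesLE.comp_tendsto htend
    have h2 : ((fun N : ℕ => (N : ℝ)) ∘ (fun x : ℕ => Bh * x)) =O[atTop]
        (fun x : ℕ => (x : ℝ)) := by
      refine Asymptotics.IsBigO.of_bound (Bh : ℝ) (Eventually.of_forall (fun x => ?_))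
      simp only [Function.comp_apply, Nat.cast_mul, norm_mul, Real.norm_natCast, le_refl]
    exact h1.trans_isBigO h2
  -- the core estimate at every level `L`, with cut-off `K = W (L+1) L`
  choose w hw using fun L : ℕ =>
    OmegaAPToLiouville.core_estimate f hf N₀ hN₀ Bh hBh1 hBh W hW L (W * (L + 1) * L) q a hq
  -- `L = 3R`, so that the residual `5x/L` is at most `2x/R`
  refine isLittleO_of_forall_approx R₀
    (fun R x => |∑ c ∈ Finset.range (q * Nat.factorial (3 * R) ^ (W * (3 * R + 1) * (3 * R))),
          w (3 * R) c * ∑ n ∈ (Finset.Icc 1 x).filter (fun n : ℕ =>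
              n ≡ c [MOD q * Nat.factorial (3 * R) ^ (W * (3 * R + 1) * (3 * R))]),
            (-1 : ℝ) ^ ArithmeticFunction.cardDistinctFactors ((f.eval (n : ℤ)).toNat)|
        + (2 * N₀ + W * (((3 * R : ℕ) : ℝ) + 1) + 4 * ((Nat.primesLE (Bh * x)).card : ℝ))) ?_ ?_
  · -- each `G_R` is `o(x)`: finitely many hypothesis sums, a constant, and `4π(Bx)`
    intro R hR
    set L := 3 * R with hLdef
    have hMpos : 0 < q * Nat.factorial L ^ (W * (L + 1) * L) :=
      Nat.mul_pos hq (pow_pos (Nat.factorial_pos L) _)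
    have hF : (fun x : ℕ => ∑ c ∈ Finset.range (q * Nat.factorial L ^ (W * (L + 1) * L)), w L c *
            ∑ n ∈ (Finset.Icc 1 x).filter
              (fun n : ℕ => n ≡ c [MOD q * Nat.factorial L ^ (W * (L + 1) * L)]),
              (-1 : ℝ) ^ ArithmeticFunction.cardDistinctFactors ((f.eval (n : ℤ)).toNat))
        =o[atTop] (fun x : ℕ => (x : ℝ)) :=
      IsLittleO.sum (fun c _ => (H f hirr hf hlc _ c hMpos).const_mul_left (w L c))
    have hconst : (fun _ : ℕ => (2 * N₀ + W * ((L : ℝ) + 1) : ℝ)) =o[atTop]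
        (fun x : ℕ => (x : ℝ)) := by
      refine Asymptotics.isLittleO_const_left.mpr (Or.inr ?_)
      refine (tendsto_natCast_atTop_atTop (R := ℝ)).congr (fun x => ?_)
      simp only [Function.comp_apply, Real.norm_natCast]
    exact (isLittleO_abs_left.mpr hF).add (hconst.add (hπ.const_mul_left 4))
  · -- the core estimate at level `L = 3R`, with `W (L+1) x / 2^K ≤ x / L`
    intro R hR hRpos x
    have h := hw (3 * R) (by omega) (fun p hp hLp => hgood p hp (by omega)) x
    set L := 3 * R with hLdef
    have hLr : (0 : ℝ) < L := by exact_mod_cast (show 0 < L by omega)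
    have hRr : (0 : ℝ) < R := by exact_mod_cast hRpos
    have h2K : (W * (L + 1) * L : ℝ) ≤ 2 ^ (W * (L + 1) * L) := by
      exact_mod_cast (Nat.lt_two_pow_self (n := W * (L + 1) * L)).le
    have hK : (W * (L + 1) : ℝ) * ((x : ℝ) / 2 ^ (W * (L + 1) * L)) ≤ (x : ℝ) / L := by
      rw [mul_div_assoc', div_le_div_iff₀ (by positivity) hLr]
      calc (W * (L + 1) : ℝ) * x * L = (W * (L + 1) * L) * x := by ring
        _ ≤ 2 ^ (W * (L + 1) * L) * x := by gcongr
        _ = x * 2 ^ (W * (L + 1) * L) := by ring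
    set mainL := ∑ c ∈ Finset.range (q * Nat.factorial L ^ (W * (L + 1) * L)), w L c *
        ∑ n ∈ (Finset.Icc 1 x).filter
          (fun n : ℕ => n ≡ c [MOD q * Nat.factorial L ^ (W * (L + 1) * L)]),
          (-1 : ℝ) ^ ArithmeticFunction.cardDistinctFactors ((f.eval (n : ℤ)).toNat) with hmainL
    have habs := abs_sub_abs_le_abs_sub
      (∑ n ∈ (Finset.Icc 1 x).filter (fun n : ℕ => n ≡ a [MOD q]),
          (ArithmeticFunction.liouville ((f.eval (n : ℤ)).toNat) : ℝ)) mainL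
    have hle := le_abs_self
      (|mainL| + (2 * N₀ + W * ((L : ℝ) + 1) + 4 * ((Nat.primesLE (Bh * x)).card : ℝ)))
    have hexp : (W * (L + 1) : ℝ) * ((x : ℝ) / 2 ^ (W * (L + 1) * L) + 1)
        = (W * (L + 1) : ℝ) * ((x : ℝ) / 2 ^ (W * (L + 1) * L)) + W * (L + 1) := by ring
    have h53 : (4 : ℝ) * x / L + x / L ≤ 2 * x / R := by
      have e1 : (4 : ℝ) * x / L + x / L = 5 / 3 * (x / R) := by
        rw [hLdef]; push_cast; field_simp; ring
      rw [e1, show (2 : ℝ) * x / R = 2 * (x / R) by ring]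
      linarith [show (0 : ℝ) ≤ x / R by positivity]
    linarith

/-- **Registered stub `stub_omegaAP_to_liouvilleAP`** of line `Sketch` (crux stmt-Parity-11585):
ω-form along every AP (the route decl `Theses.IsogenyRedei.QuadraticOmegaParity`) ⇒ λ-form along
every AP; alias of `quadraticOmegaParity_to_liouvilleAP`. [folklore] -/
theorem stub_omegaAP_to_liouvilleAP :
    Summit.Parity.BatemanHorn.Theses.IsogenyRedei.QuadraticOmegaParity →
    ∀ f : Polynomial ℤ, Irreducible f → f.natDegree = 2 → 0 < f.leadingCoeff → ∀ q a : ℕ, 0 < q →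
      (fun x : ℕ => ∑ n ∈ (Finset.Icc 1 x).filter (fun n : ℕ => n ≡ a [MOD q]),
        (ArithmeticFunction.liouville ((f.eval (n : ℤ)).toNat) : ℝ)) =o[Filter.atTop]
          fun x : ℕ => (x : ℝ) :=
  quadraticOmegaParity_to_liouvilleAP

end Summit.Parity.BatemanHorn.Theorems
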